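import Mathlib
import Literature.NumberTheory.LFunctions.Zhang2022.Section17Eval1710
import Literature.NumberTheory.LFunctions.Zhang2022.SkeletonEvalRel
import HarnessLib

/-!
# Zhang (2022), §17 p. 99 in the RELATIVE reading: (17.10)ᴿ `Skeleton.Eval1710Rel` from (17.1) and the
# RELATIVE forms of (17.6), (17.9) — the §17 member of the `𝔞`-size family (G-L4fam-1) re-pointed

Topic `Literature/NumberTheory/LFunctions/Zhang2022` (Landau–Siegel audit tree; verdict-neutral).
Y. Zhang, *Discrete mean estimates and the Landau–Siegel zero*, arXiv:2211.02515v1 (2022)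
[Zhang2022LandauSiegel] — **an unrefereed manuscript under adjudication**; the displays referred to are
CLAIM nodes (`Typed.Section17`, `SkeletonPartThree`, `SkeletonEvalRel`), stated not asserted.

The §2 p. 6 composition consumes (17.10) only in its relative form `Skeleton.Eval1710Rel c′`
(`‖Φ₃ + (𝔢₀+𝔢₁)𝔞𝔓‖ ≤ ε(𝔞+1)𝔓`; `SkeletonEvalRel.eval181Rel_of_parts`). The tree reaches it through the
ABSOLUTE (17.10) (`Phi3Eval.eval1710_of : Eq17_1 → Eq17_6 → Eq17_9 → Eval1710`), whose inputs (17.6),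
(17.9) are ABSOLUTE `o(𝔓)` displays; below (17.9) sits the unprinted summed-error input `hE` of §17.u024
(GAP row G-d58-1), a member of the family «size of `L′(1,χ)` / `𝔞` under (A)» (G-L4fam-1), for which TEAM A
ADOPTED the relative-reading dissolution (D-G-L4fam-1, 2026-08-26T00:51Z: relative errors `ε(𝔞+1)𝔓` are
consumer-sufficient). This file supplies the §17 edge for that reading — pure bookkeeping, the relative twin
of `Phi3Eval.eval1710_of`:

* `eval1710Rel_of_rel` — (17.1) + (17.6)ᴿ + (17.9)ᴿ ⇒ `Eval1710Rel c′`, where (17.6)ᴿ / (17.9)ᴿ are the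
  displays (17.6) / (17.9) with `o(𝔓)` read `ε(𝔞+1)𝔓` (stated INLINE — no new definition is introduced;
  a typed name is the L4 typers' / the cone pen's call);
* `eq17_6Rel_of_eq17_6`, `eq17_9Rel_of_eq17_9` — the absolute displays imply the relative ones, so carrying
  the §17 leaves at the relative reading is a WEAKENING of the frontier hypotheses, never a strengthening.

Nothing is asserted about (17.1), (17.6), (17.9) themselves, about Theorems 1–2 of the source, or about the
cell's verdict on (8.24) / `Margin232`.

## References

* Y. Zhang, arXiv:2211.02515v1 (2022), §17 (17.1), (17.6), (17.9), (17.10), pp. 95–99.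
  [cite: Zhang2022LandauSiegel, §17 (17.10) p.99]
-/

noncomputable section

open Complex Real
open Literature.NumberTheory.LFunctions.Zhang2022.Skeleton
open Literature.NumberTheory.LFunctions.Zhang2022.Typed.Section17

namespace Literature.NumberTheory.LFunctions.Zhang2022.Phi3Eval

/-- **(17.6) ⇒ (17.6)ᴿ**: the absolute display implies its relative reading (`ε𝔓 ≤ ε(𝔞+1)𝔓`).
[cite: Zhang2022LandauSiegel, §17 (17.6)] -/
theorem eq17_6Rel_of_eq17_6 {c' : ℝ} (h6 : Eq17_6 c') :
    ∀ ε : ℝ, 0 < ε → ForAllLarge fun D _ χ => AssumptionA D χ →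
      ‖(∑ x ∈ finsetOf (PsiOne χ), (((x.p : ℝ) * t0 D : ℝ) : ℂ) ^ beta3 c' D * I4 c' χ x (alpha D)) +
          frake0 * frakA χ * frakP D‖ ≤ ε * (frakA χ + 1) * frakP D := fun ε hε =>
  (h6 ε hε).mono fun D _ χ _ _ hS hA => by
    have h := hS hA
    have hA0 : 0 ≤ frakA χ := frakA_nonneg χ
    have hP0 : 0 ≤ frakP D := frakP_nonneg D
    nlinarith [mul_nonneg (mul_nonneg hε.le hA0) hP0]

/-- **(17.9) ⇒ (17.9)ᴿ**: the absolute display implies its relative reading.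
[cite: Zhang2022LandauSiegel, §17 (17.9)] -/
theorem eq17_9Rel_of_eq17_9 {c' : ℝ} (h9 : Eq17_9 c') :
    ∀ ε : ℝ, 0 < ε → ForAllLarge fun D _ χ => AssumptionA D χ →
      ‖(∑ x ∈ finsetOf (PsiOne χ), (((x.p : ℝ) * t0 D : ℝ) : ℂ) ^ beta3 c' D * I4 c' χ x (-alpha D)) -
          frake 1 * frakA χ * frakP D‖ ≤ ε * (frakA χ + 1) * frakP D := fun ε hε =>
  (h9 ε hε).mono fun D _ χ _ _ hS hA => by
    have h := hS hA
    have hA0 : 0 ≤ frakA χ := frakA_nonneg χ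
    have hP0 : 0 ≤ frakP D := frakP_nonneg D
    nlinarith [mul_nonneg (mul_nonneg hε.le hA0) hP0]

/-- **(17.10)ᴿ from (17.1), (17.6)ᴿ and (17.9)ᴿ** (§17 p. 99: "Finally, from (17.1), (17.6) and (17.9)
we conclude `Φ₃ = −(𝔢₀ + 𝔢₁)𝔞𝔓 + o(𝔓)` (17.10)", in the relative reading `o((𝔞+1)𝔓)` of the family
ruling D-G-L4fam-1); the conclusion is the node `Skeleton.Eval1710Rel c′` BY NAME, the one the §18
assembly consumes. The `O(ε)` of (17.1), `ε = e^{−c𝓛¹⁰}`, is `≤ |C| ≤ (ε/3)𝓛 ≤ (ε/3)D ≤ (ε/3)𝔓 ≤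
(ε/3)(𝔞+1)𝔓` for large `D`. Relative twin of `Phi3Eval.eval1710_of`.
[cite: Zhang2022LandauSiegel, §17 (17.10) p.99] -/
theorem eval1710Rel_of_rel {c' : ℝ} (h1 : Eq17_1 c')
    (h6R : ∀ ε : ℝ, 0 < ε → ForAllLarge fun D _ χ => AssumptionA D χ →
      ‖(∑ x ∈ finsetOf (PsiOne χ), (((x.p : ℝ) * t0 D : ℝ) : ℂ) ^ beta3 c' D * I4 c' χ x (alpha D)) +
          frake0 * frakA χ * frakP D‖ ≤ ε * (frakA χ + 1) * frakP D)
    (h9R : ∀ ε : ℝ, 0 < ε → ForAllLarge fun D _ χ => AssumptionA D χ →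
      ‖(∑ x ∈ finsetOf (PsiOne χ), (((x.p : ℝ) * t0 D : ℝ) : ℂ) ^ beta3 c' D * I4 c' χ x (-alpha D)) -
          frake 1 * frakA χ * frakP D‖ ≤ ε * (frakA χ + 1) * frakP D) :
    Eval1710Rel c' := by
  intro ε hε
  obtain ⟨c₀, hc₀, C, hC⟩ := h1
  have hε3 : 0 < ε / 3 := by positivity
  obtain ⟨D₀, hall⟩ :=
    (((hC.and (h6R _ hε3)).and (h9R _ hε3)).and forAllLarge_self_le_frakP).and
      (forAllLarge_le_ell (3 * |C| / ε + 1))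
  refine ⟨D₀, fun D _ χ hD hq hp hA => ?_⟩
  obtain ⟨⟨⟨⟨e1, e6⟩, e9⟩, hPD⟩, hℓ⟩ := hall D χ hD hq hp
  set Xp : ℂ := ∑ x ∈ finsetOf (PsiOne χ),
    (((x.p : ℝ) * t0 D : ℝ) : ℂ) ^ beta3 c' D * I4 c' χ x (alpha D) with hXp
  set Xm : ℂ := ∑ x ∈ finsetOf (PsiOne χ),
    (((x.p : ℝ) * t0 D : ℝ) : ℂ) ^ beta3 c' D * I4 c' χ x (-alpha D) with hXm
  have hPnn : 0 ≤ frakP D := frakP_nonneg D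
  have hA0 : 0 ≤ frakA χ := frakA_nonneg χ
  have hAP : frakP D ≤ (frakA χ + 1) * frakP D := by nlinarith
  have hsum : ∑ x ∈ finsetOf (PsiOne χ), (((x.p : ℝ) * t0 D : ℝ) : ℂ) ^ beta3 c' D *
      (I4 c' χ x (alpha D) - I4 c' χ x (-alpha D)) = Xp - Xm := by
    rw [hXp, hXm, ← Finset.sum_sub_distrib]
    exact Finset.sum_congr rfl fun x _ => by ring
  have hb1 : ‖Phi3 c' χ - (Xp - Xm)‖ ≤ ε / 3 * ((frakA χ + 1) * frakP D) := by
    have h1' : ‖Phi3 c' χ - (Xp - Xm)‖ ≤ C * Real.exp (-c₀ * ell D ^ 10) := by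
      rw [← hsum]; exact e1 hA
    have hℓ0 : 0 < ell D := by
      have : 0 ≤ 3 * |C| / ε := by positivity
      linarith
    have hexp : Real.exp (-c₀ * ell D ^ 10) ≤ 1 := by
      rw [Real.exp_le_one_iff]
      have : 0 ≤ ell D ^ 10 := by positivity
      nlinarith
    have h2 : C * Real.exp (-c₀ * ell D ^ 10) ≤ |C| :=
      (le_abs_self _).trans (by
        rw [abs_mul, abs_of_nonneg (Real.exp_nonneg _)]
        exact mul_le_of_le_one_right (abs_nonneg _) hexp)
    have hDpos : (0 : ℝ) < D := by exact_mod_cast Nat.pos_of_ne_zero (NeZero.ne D)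
    have hℓD : ell D ≤ D := (Real.log_le_sub_one_of_pos hDpos).trans (by linarith)
    have h3 : |C| ≤ ε / 3 * ell D := by
      have : 3 * |C| / ε ≤ ell D := by linarith
      rw [div_le_iff₀ hε] at this
      linarith
    have h4 : |C| ≤ ε / 3 * ((frakA χ + 1) * frakP D) :=
      h3.trans (mul_le_mul_of_nonneg_left ((hℓD.trans hPD).trans hAP) hε3.le)
    linarith
  have hb2 : ‖Xp + frake0 * frakA χ * frakP D‖ ≤ ε / 3 * (frakA χ + 1) * frakP D := e6 hA
  have hb3 : ‖Xm - frake 1 * frakA χ * frakP D‖ ≤ ε / 3 * (frakA χ + 1) * frakP D := e9 hA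
  have hsplit : Phi3 c' χ + (frake0 + frake 1) * frakA χ * frakP D =
      (Phi3 c' χ - (Xp - Xm)) + (Xp + frake0 * frakA χ * frakP D) -
        (Xm - frake 1 * frakA χ * frakP D) := by ring
  rw [hsplit]
  calc ‖(Phi3 c' χ - (Xp - Xm)) + (Xp + frake0 * frakA χ * frakP D) -
        (Xm - frake 1 * frakA χ * frakP D)‖
      ≤ ‖Phi3 c' χ - (Xp - Xm)‖ + ‖Xp + frake0 * frakA χ * frakP D‖ +
        ‖Xm - frake 1 * frakA χ * frakP D‖ :=
          (norm_sub_le _ _).trans (add_le_add (norm_add_le _ _) le_rfl)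
    _ ≤ ε / 3 * ((frakA χ + 1) * frakP D) + ε / 3 * (frakA χ + 1) * frakP D +
        ε / 3 * (frakA χ + 1) * frakP D := add_le_add (add_le_add hb1 hb2) hb3
    _ = ε * (frakA χ + 1) * frakP D := by ring

/-- **The current (absolute) §17 leaves still suffice**: (17.1) + (17.6) + (17.9) ⇒ `Eval1710Rel c′`
through the relative edge (consistency check: `eval1710Rel_of_rel ∘` the two weakenings, equal in
strength to `eval1710Rel_of_eval1710 ∘ eval1710_of`). [cite: Zhang2022LandauSiegel, §17 (17.10) p.99] -/
theorem eval1710Rel_of_abs {c' : ℝ} (h1 : Eq17_1 c') (h6 : Eq17_6 c') (h9 : Eq17_9 c') :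
    Eval1710Rel c' :=
  eval1710Rel_of_rel h1 (eq17_6Rel_of_eq17_6 h6) (eq17_9Rel_of_eq17_9 h9)

end Literature.NumberTheory.LFunctions.Zhang2022.Phi3Eval
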